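import Summits.QuantumAdvantage.AdviceFreeQNC0.AffBells26TargetFormula

/-!
# AffBells35 — the ODD-DEVIATION NORMAL FORM of the ring relation (ask P-38n of planner qa-qnc0-p1 g35, ROUND-34 §12.6(i))

Cell qa-qnc0, route DWalkThree (crux stmt-QuantumAdvantage-22907; statement language for the `Q*` programme); prover qn-prover-3 g19.

On an odd input `x` of the `N`-cycle (`N ≥ 3`) with kernel line `J = kline x` (the ACTIVE positions), coins `Z = zeros J` and
distance-two coin pairs `p = pairs2 J`:

* `card_active_prv_mod_two` — **`#{h active : x_{h−1} = 1} ≡ N + Z + p + 1 (mod 2)`** (and `card_active_nxt_mod_two`, the mirror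
  image with `x_{h+1}`).  Proof: re-index by `i = h − 1`; the active `i` with `J_{i+1} = 1` and `x_i = 1` are, by the kernel equation
  `x_i = J_{i−1} ⊕ J_{i+1}` (`Fib19.apply_eq_of_kline`), exactly those with a coin at `i − 1`, i.e. `Z − p` of them
  (`AffBells26.coins_split_nxt`); the coins `i` (then `J_{i+1} = 1` automatically, hard-core) contribute the coin ones, and
  `#coin ones = #ones − |x ∧ J| = (N − zeros x) − (2Z − 2p)` (`AffBells26.wtAnd_kline_add`) with `zeros x` odd (`Fib19.isOdd_iff`).
* `rel_iff_odd_deviation` — **`Rel x z ⟺ #{h active : z_h ≠ x_{h−1}}` is ODD**, for EVERY answer string `z` (from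
  `AffBells26.targetFormula`: `Rel x z ⟺ #{h active : z_h} + N + Z + p ≡ 0`), and its mirror `rel_iff_odd_deviation_nxt`;
  `affBell_rel_iff_odd_deviation` — the same for the affine MOD₃ bell strategies `z_h = [⟨β_h, x⟩ = c_h]`.

Reading (planner): every active player has a canonical LOCAL answer (copy your left input bit); a strategy wins at `x` exactly when an
odd number of active players deviate from it.
WHAT THIS IS NOT: no crux closed; separation NOT moved; a normal form only.
-/

namespace Summit.QuantumAdvantage.AdviceFreeQNC0.AffBells35

open Finset Literature.Computability.QuantumComplexity Literature.Computability.QuantumComplexity.RingHLF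
open AffBells23 Fib19 AffBells26

variable {N : ℕ}

/-- counting a symmetric difference inside the active set: `#{J ∧ z ≠ w} + 2·#{J ∧ z ∧ w} = #{J ∧ z} + #{J ∧ w}`. -/
theorem card_filter_ne_add (J z w : Fin N → Bool) :
    (univ.filter fun h => J h = true ∧ z h ≠ w h).card
      + 2 * (univ.filter fun h => J h = true ∧ z h = true ∧ w h = true).card
      = (univ.filter fun h => J h = true ∧ z h = true).card + (univ.filter fun h => J h = true ∧ w h = true).card := by
  simp only [card_filter, mul_sum, ← sum_add_distrib]
  refine sum_congr rfl fun h _ => ?_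
  cases J h <;> cases z h <;> cases w h <;> simp

/-- the ones of `x` split into active ones and coin ones: `|x ∧ J| + #{i coin : x_i = 1} + zeros x = N`. -/
theorem wtAnd_add_coinOnes_add_zeros (x J : Fin N → Bool) :
    wtAnd x J + (univ.filter fun i : Fin N => J i = false ∧ x i = true).card + zeros x = N := by
  have hsp := card_filter_add_card_filter_not (s := (univ : Finset (Fin N))) (p := fun i : Fin N => x i = true)
  rw [card_univ, Fintype.card_fin] at hsp
  have e1 : (univ.filter fun i : Fin N => x i = true)
      = (univ.filter fun b : Fin N => x b = true ∧ J b = true) ∪ (univ.filter fun i : Fin N => J i = false ∧ x i = true) := by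
    ext i
    simp only [mem_union, mem_filter, mem_univ, true_and]
    cases J i <;> simp
  have hd : Disjoint (univ.filter fun b : Fin N => x b = true ∧ J b = true)
      (univ.filter fun i : Fin N => J i = false ∧ x i = true) := by
    rw [disjoint_left]
    intro i h1 h2
    rw [mem_filter] at h1 h2
    rw [h1.2.2] at h2
    simp at h2
  have e2 : (univ.filter fun i : Fin N => ¬ x i = true) = univ.filter fun i : Fin N => x i = false := by
    refine filter_congr fun i _ => ?_
    simp
  rw [e1, card_union_of_disjoint hd, e2] at hsp
  unfold wtAnd zeros
  omega

/-- **ODD-DEVIATION COUNT** (left neighbour): on an odd input, `#{h active : x_{h−1} = 1} ≡ N + Z + pairs2 + 1 (mod 2)`. -/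
theorem card_active_prv_mod_two (hN : 3 ≤ N) (x : Fin N → Bool) (hodd : IsOdd x) :
    (univ.filter fun h : Fin N => kline x h = true ∧ x (prv h) = true).card % 2
      = (N + zeros (kline x) + pairs2 (kline x) + 1) % 2 := by
  set J := kline x with hJdef
  have hJ : HardCore J := kline_hardCore hN x hodd
  -- re-index by `i = h − 1`
  have h0 : (univ.filter fun h : Fin N => J h = true ∧ x (prv h) = true).card
      = (univ.filter fun i : Fin N => J (nxt i) = true ∧ x i = true).card := by
    rw [← card_filter_comp prv nxt prv_nxt nxt_prv (fun i => J (nxt i) = true ∧ x i = true)]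
    congr 1
    ext h
    simp only [mem_filter, mem_univ, true_and, nxt_prv]
  -- split by whether `i` itself is active
  set P₁ := univ.filter fun i : Fin N => J i = true ∧ J (nxt i) = true ∧ x i = true with hP₁
  set P₂ := univ.filter fun i : Fin N => J i = false ∧ x i = true with hP₂
  have hsplit : (univ.filter fun i : Fin N => J (nxt i) = true ∧ x i = true) = P₁ ∪ P₂ := by
    ext i
    simp only [hP₁, hP₂, mem_union, mem_filter, mem_univ, true_and]
    constructor
    · rintro ⟨h1, h2⟩
      cases hi : J i
      · exact Or.inr ⟨rfl, h2⟩
      · exact Or.inl ⟨rfl, h1, h2⟩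
    · rintro (⟨_, h2, h3⟩ | ⟨h1, h2⟩)
      · exact ⟨h2, h3⟩
      · refine ⟨?_, h2⟩
        by_contra hc
        rw [Bool.not_eq_true] at hc
        exact hJ.1 i ⟨h1, hc⟩
  have hdisj : Disjoint P₁ P₂ := by
    rw [disjoint_left]
    intro i h1 h2
    rw [hP₁, mem_filter] at h1
    rw [hP₂, mem_filter] at h2
    rw [h1.2.1] at h2
    simp at h2
  -- `P₁` = the active `i` with `J_{i+1} = 1` and a coin at `i − 1` (kernel equation); re-indexed by that coin: `Z − p`
  have hP₁card : P₁.card + pairs2 J = zeros J := by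
    have e1 : P₁ = univ.filter fun i : Fin N => J (prv i) = false ∧ J i = true ∧ J (nxt i) = true := by
      ext i
      simp only [hP₁, mem_filter, mem_univ, true_and]
      constructor
      · rintro ⟨h1, h2, h3⟩
        have hx := apply_eq_of_kline hN x hodd i h1
        rw [← hJdef, h3, h2] at hx
        refine ⟨?_, h1, h2⟩
        revert hx
        cases J (prv i) <;> simp
      · rintro ⟨h1, h2, h3⟩
        refine ⟨h2, h3, ?_⟩
        have hx := apply_eq_of_kline hN x hodd i h2
        rw [← hJdef, h1, h3] at hx
        rw [hx]
        rfl
    have e2 : (univ.filter fun i : Fin N => J (prv i) = false ∧ J i = true ∧ J (nxt i) = true).card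
        = (univ.filter fun q : Fin N => J q = false ∧ J (nxt (nxt q)) = true).card := by
      rw [← card_filter_comp nxt prv nxt_prv prv_nxt
        (fun i => J (prv i) = false ∧ J i = true ∧ J (nxt i) = true)]
      congr 1
      ext q
      simp only [mem_filter, mem_univ, true_and, prv_nxt]
      constructor
      · rintro ⟨h1, _, h3⟩
        exact ⟨h1, h3⟩
      · rintro ⟨h1, h3⟩
        refine ⟨h1, ?_, h3⟩
        by_contra hc
        rw [Bool.not_eq_true] at hc
        exact hJ.1 q ⟨h1, hc⟩
    rw [e1, e2]
    exact coins_split_nxt J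
  have hP₂card : wtAnd x J + P₂.card + zeros x = N := wtAnd_add_coinOnes_add_zeros x J
  have hw := wtAnd_kline_add hN x hodd
  rw [← hJdef] at hw
  have hz := (isOdd_iff x).1 hodd
  rw [h0, hsplit, card_union_of_disjoint hdisj]
  omega

/-- **ODD-DEVIATION COUNT** (right neighbour): on an odd input, `#{h active : x_{h+1} = 1} ≡ N + Z + pairs2 + 1 (mod 2)`. -/
theorem card_active_nxt_mod_two (hN : 3 ≤ N) (x : Fin N → Bool) (hodd : IsOdd x) :
    (univ.filter fun h : Fin N => kline x h = true ∧ x (nxt h) = true).card % 2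
      = (N + zeros (kline x) + pairs2 (kline x) + 1) % 2 := by
  set J := kline x with hJdef
  have hJ : HardCore J := kline_hardCore hN x hodd
  have hJ' : ∀ i : Fin N, J i = false → J (prv i) = true := by
    intro i hi
    by_contra hc
    rw [Bool.not_eq_true] at hc
    exact hJ.1 (prv i) ⟨hc, by rw [nxt_prv]; exact hi⟩
  -- re-index by `i = h + 1`
  have h0 : (univ.filter fun h : Fin N => J h = true ∧ x (nxt h) = true).card
      = (univ.filter fun i : Fin N => J (prv i) = true ∧ x i = true).card := by
    rw [← card_filter_comp nxt prv nxt_prv prv_nxt (fun i => J (prv i) = true ∧ x i = true)]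
    congr 1
    ext h
    simp only [mem_filter, mem_univ, true_and, prv_nxt]
  set P₁ := univ.filter fun i : Fin N => J i = true ∧ J (prv i) = true ∧ x i = true with hP₁
  set P₂ := univ.filter fun i : Fin N => J i = false ∧ x i = true with hP₂
  have hsplit : (univ.filter fun i : Fin N => J (prv i) = true ∧ x i = true) = P₁ ∪ P₂ := by
    ext i
    simp only [hP₁, hP₂, mem_union, mem_filter, mem_univ, true_and]
    constructor
    · rintro ⟨h1, h2⟩
      cases hi : J i
      · exact Or.inr ⟨rfl, h2⟩
      · exact Or.inl ⟨rfl, h1, h2⟩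
    · rintro (⟨_, h2, h3⟩ | ⟨h1, h2⟩)
      · exact ⟨h2, h3⟩
      · exact ⟨hJ' i h1, h2⟩
  have hdisj : Disjoint P₁ P₂ := by
    rw [disjoint_left]
    intro i h1 h2
    rw [hP₁, mem_filter] at h1
    rw [hP₂, mem_filter] at h2
    rw [h1.2.1] at h2
    simp at h2
  -- `P₁` = the active `i` with `J_{i−1} = 1` and a coin at `i + 1`; re-indexed by that coin: `Z − p` (`coins_split_prv`)
  have hP₁card : P₁.card + pairs2 J = zeros J := by
    have e1 : P₁ = univ.filter fun i : Fin N => J (nxt i) = false ∧ J i = true ∧ J (prv i) = true := by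
      ext i
      simp only [hP₁, mem_filter, mem_univ, true_and]
      constructor
      · rintro ⟨h1, h2, h3⟩
        have hx := apply_eq_of_kline hN x hodd i h1
        rw [← hJdef, h3, h2] at hx
        refine ⟨?_, h1, h2⟩
        revert hx
        cases J (nxt i) <;> simp
      · rintro ⟨h1, h2, h3⟩
        refine ⟨h2, h3, ?_⟩
        have hx := apply_eq_of_kline hN x hodd i h2
        rw [← hJdef, h1, h3] at hx
        rw [hx]
        rfl
    have e2 : (univ.filter fun i : Fin N => J (nxt i) = false ∧ J i = true ∧ J (prv i) = true).card
        = (univ.filter fun q : Fin N => J q = false ∧ J (prv (prv q)) = true).card := by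
      rw [← card_filter_comp prv nxt prv_nxt nxt_prv
        (fun i => J (nxt i) = false ∧ J i = true ∧ J (prv i) = true)]
      congr 1
      ext q
      simp only [mem_filter, mem_univ, true_and, nxt_prv]
      constructor
      · rintro ⟨h1, _, h3⟩
        exact ⟨h1, h3⟩
      · rintro ⟨h1, h3⟩
        exact ⟨h1, hJ' q h1, h3⟩
    rw [e1, e2]
    exact coins_split_prv J
  have hP₂card : wtAnd x J + P₂.card + zeros x = N := wtAnd_add_coinOnes_add_zeros x J
  have hw := wtAnd_kline_add hN x hodd
  rw [← hJdef] at hw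
  have hz := (isOdd_iff x).1 hodd
  rw [h0, hsplit, card_union_of_disjoint hdisj]
  omega

/-- **ODD-DEVIATION NORMAL FORM** (P-38n): on an odd input, an answer string satisfies the ring relation iff an ODD number of
active players `h` deviate from the canonical local answer "copy your left input bit `x_{h−1}`". -/
theorem rel_iff_odd_deviation (hN : 3 ≤ N) (x : Fin N → Bool) (hodd : IsOdd x) (z : Fin N → Bool) :
    RingHLF.Rel x z ↔ (univ.filter fun h : Fin N => kline x h = true ∧ z h ≠ x (prv h)).card % 2 = 1 := by
  rw [targetFormula N hN x hodd z]
  have h1 := card_active_prv_mod_two hN x hodd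
  have h2 := card_filter_ne_add (kline x) z (fun h => x (prv h))
  unfold activeOnes
  constructor
  · intro h; omega
  · intro h; omega

/-- the mirror image: `Rel x z ⟺ #{h active : z_h ≠ x_{h+1}}` is odd. -/
theorem rel_iff_odd_deviation_nxt (hN : 3 ≤ N) (x : Fin N → Bool) (hodd : IsOdd x) (z : Fin N → Bool) :
    RingHLF.Rel x z ↔ (univ.filter fun h : Fin N => kline x h = true ∧ z h ≠ x (nxt h)).card % 2 = 1 := by
  rw [targetFormula N hN x hodd z]
  have h1 := card_active_nxt_mod_two hN x hodd
  have h2 := card_filter_ne_add (kline x) z (fun h => x (nxt h))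
  unfold activeOnes
  constructor
  · intro h; omega
  · intro h; omega

/-- **P-38n for the affine MOD₃ bells**: `β` wins at the odd input `x` iff an odd number of active rows `h` have
`[⟨β_h, x⟩ = c_h] ≠ x_{h−1}`. -/
theorem affBell_rel_iff_odd_deviation (hN : 3 ≤ N) (β : Fin N → Fin N → ZMod 3) (c : Fin N → ZMod 3)
    (x : Fin N → Bool) (hodd : IsOdd x) :
    RingHLF.Rel x (affBell β c x)
      ↔ (univ.filter fun h : Fin N => kline x h = true ∧ affBell β c x h ≠ x (prv h)).card % 2 = 1 :=
  rel_iff_odd_deviation hN x hodd _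

end Summit.QuantumAdvantage.AdviceFreeQNC0.AffBells35
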